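import Summits.Ventures.GridStability.Models.WSCC9FaultOnTube

/-!
# WSCC9FaultOnTube9 — the bus-7 fault-on kernel TUBE of the WSCC 3-machine model re-derived up to `T = 9/100 s` (rider «LOWER-K ∀ t_cl ≤ 9/100 s»)

Venture GRIDFUSION (LADDER-GRIDFUSION G1-cct; sos-1 g6 2026-08-27T09:32:50Z: ONE degree-2 Putinar certificate
certifies the union box `U(T₁) ⊂ {V_deg4 ≤ 1159/1000}` up to `T₁ ≈ 0.09 s` PROVIDED the tube holds to `T₁`), seat
gridfusion-model-1.  The literals of `WSCC9.faultBus7_tube_9_100` (p510936) are stated for `T ≤ 1/12` and their inclusions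
`K(T) ⊂ int B` fail at `T = 9/100`; this file repeats the SAME kernel recipe on a wider box:
`B′ = [−0.001, 0.005] × [0.3, 0.51] × [0.19, 0.315]` (angles, reference translated to `0`) `× [−0.001, 0.09] × [−0.001, 4.4] ×
[−0.001, 2.75]` (printed speeds), angle difference `a3 ∈ [0.185, 0.316]` on `B′` (`sin ∈ [0.1839, 0.3108]`,
`cos ∈ [0.949, 0.983]` by `Real.sin_bound` / `Real.cos_bound`), field bounds `tubeLo9 = (32/125, 5891/125, 4661/200) =
(0.256, 47.128, 23.305)`, `tubeHi9 = (243/250, 48009/1000, 29677/1000) = (0.972, 48.009, 29.677)` rad/s² (outward 3-dp).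
STATEMENT `faultBus7_tube_9_100`: for every `T ∈ [0, 9/100]`, every solution of `faultBus7Printed` on `[0, T]` from the
printed pre-fault point at rest, every `t ∈ [0, T]`: `tubeLo9_i t ≤ ω_i(t) ≤ tubeHi9_i t`, `tubeLo9_i t²/2 ≤ δ_i(t) − δ_i(0)
≤ tubeHi9_i t²/2`.  UNION BOX `U(9/100)` for the «K ⊂ S» consumer: `a2 ∈ [0.300743, 0.499216]`, `a3 ∈ [0.186313, 0.310542]`,
printed speeds `∈ [0, tubeHi9_j·9/100]`.  THREE COLUMNS: CERTIFIED = tube sentence for MODEL M′ (classical WSCC9,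
MV-2 + MV-P + MV-SPD + MV-h12, bolted fault at bus 7); VALIDATED = model-4's exact tube; no stability claim.
[cite: Moore1979, §8.1 eqs. (8.5), (8.10); AndersonFouad1977, Example 2.6 / §2.10]
-/

noncomputable section

open Real Set Finset

namespace Summit.Ventures.GridStability.Models

namespace WSCC9

/-- Lower acceleration bounds of the tube (rad/s²), machines 1, 2, 3: `(0.256, 47.128, 23.305)` (valid to `T = 9/100`). -/
def tubeLo9 : Fin 3 → ℝ := ![32 / 125, 5891 / 125, 4661 / 200]

/-- Upper acceleration bounds of the tube (rad/s²), machines 1, 2, 3: `(0.972, 48.009, 29.677)` (valid to `T = 9/100`). -/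
def tubeHi9 : Fin 3 → ℝ := ![243 / 250, 48009 / 1000, 29677 / 1000]

/-- Angle box of the field-bound region `B` (reference angle translated to `0`): lower corners. -/
def boxA9 : Fin 3 → ℝ := ![-1 / 1000, 3 / 10, 19 / 100]
/-- Angle box of `B`: upper corners. -/
def boxB9 : Fin 3 → ℝ := ![1 / 200, 51 / 100, 63 / 200]
/-- Speed box of `B`: lower corners. -/
def boxC9 : Fin 3 → ℝ := ![-1 / 1000, -1 / 1000, -1 / 1000]
/-- Speed box of `B`: upper corners. -/
def boxD9 : Fin 3 → ℝ := ![9 / 100, 22 / 5, 11 / 4]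

/-- `sin` and `cos` enclosures on `[0.185, 0.316]` (monotonicity + `Real.sin_bound` / `Real.cos_bound`). -/
theorem trig_bounds_a3_9 {s : ℝ} (hs : s ∈ Icc (37 / 200 : ℝ) (79 / 250)) :
    (0.1839 : ℝ) ≤ Real.sin s ∧ Real.sin s ≤ 0.3108 ∧ (0.949 : ℝ) ≤ Real.cos s ∧ Real.cos s ≤ 0.983 := by
  obtain ⟨h1, h2⟩ := hs
  have hπ := Real.pi_gt_three
  have hsin_lo : Real.sin (37 / 200) ≤ Real.sin s :=
    Real.sin_le_sin_of_le_of_le_pi_div_two (by linarith) (by linarith) h1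
  have hsin_hi : Real.sin s ≤ Real.sin (79 / 250) :=
    Real.sin_le_sin_of_le_of_le_pi_div_two (by linarith) (by linarith) h2
  have hcos_hi : Real.cos s ≤ Real.cos (37 / 200) :=
    Real.cos_le_cos_of_nonneg_of_le_pi (by norm_num) (by linarith) h1
  have hcos_lo : Real.cos (79 / 250) ≤ Real.cos s :=
    Real.cos_le_cos_of_nonneg_of_le_pi (by linarith) (by linarith) h2
  have b1 := Real.sin_bound (x := (37 / 200 : ℝ)) (by rw [abs_of_nonneg (by norm_num)]; norm_num)
  have b2 := Real.sin_bound (x := (79 / 250 : ℝ)) (by rw [abs_of_nonneg (by norm_num)]; norm_num)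
  have b3 := Real.cos_bound (x := (37 / 200 : ℝ)) (by rw [abs_of_nonneg (by norm_num)]; norm_num)
  have b4 := Real.cos_bound (x := (79 / 250 : ℝ)) (by rw [abs_of_nonneg (by norm_num)]; norm_num)
  rw [abs_of_nonneg (by norm_num : (0 : ℝ) ≤ 37 / 200)] at b1 b3
  rw [abs_of_nonneg (by norm_num : (0 : ℝ) ≤ 79 / 250)] at b2 b4
  obtain ⟨b1l, b1u⟩ := abs_le.1 b1
  obtain ⟨b2l, b2u⟩ := abs_le.1 b2
  obtain ⟨b3l, b3u⟩ := abs_le.1 b3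
  obtain ⟨b4l, b4u⟩ := abs_le.1 b4
  norm_num at b1l b1u b2l b2u b3l b3u b4l b4u ⊢
  refine ⟨by linarith, by linarith, by linarith, by linarith⟩

/-- **Kernel field bounds on the wider box `B′`.** For every state with angles in `[boxA9, boxB9]` (reference
translated to `0`) and speeds in `[boxC9, boxD9]`, the accelerations of `faultBus7Printed` lie in
`[tubeLo9, tubeHi9]`. -/
theorem faultBus7Printed_fieldBounds9 (x : ClassicalSwing.State 3)
    (hx : ∀ i, boxA9 i ≤ x.1 i ∧ x.1 i ≤ boxB9 i ∧ boxC9 i ≤ x.2 i ∧ x.2 i ≤ boxD9 i) :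
    ∀ i, tubeLo9 i ≤ (faultBus7Printed.field x).2 i ∧ (faultBus7Printed.field x).2 i ≤ tubeHi9 i := by
  have h0 := hx 0
  have h1 := hx 1
  have h2 := hx 2
  simp only [boxA9, boxB9, boxC9, boxD9, Matrix.cons_val_zero, Matrix.cons_val_one, Matrix.head_cons,
    Matrix.cons_val_two, Matrix.tail_cons] at h0 h1 h2
  -- the angle difference a3 = x.1 2 − x.1 0 ∈ [0.185, 0.316]
  have ha3 : x.1 2 - x.1 0 ∈ Icc (37 / 200 : ℝ) (79 / 250) := ⟨by linarith, by linarith⟩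
  obtain ⟨hs1, hs2, hc1, hc2⟩ := trig_bounds_a3_9 ha3
  have hsin' : Real.sin (x.1 0 - x.1 2) = -Real.sin (x.1 2 - x.1 0) := by
    rw [← Real.sin_neg]; ring_nf
  have hcos' : Real.cos (x.1 0 - x.1 2) = Real.cos (x.1 2 - x.1 0) := by
    rw [← Real.cos_neg]; ring_nf
  have hm0 : tubeLo9 0 ≤ (faultBus7Printed.field x).2 0 ∧ (faultBus7Printed.field x).2 0 ≤ tubeHi9 0 := by
    rw [faultBus7Printed_field_snd, faultBus7_Pe_zero, hsin', hcos']
    simp only [tubeLo9, tubeHi9, Pprinted, D_SP, M, Matrix.cons_val_zero]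
    push_cast
    constructor
    · rw [le_div_iff₀ (by norm_num)]; nlinarith
    · rw [div_le_iff₀ (by norm_num)]; nlinarith
  have hm1 : tubeLo9 1 ≤ (faultBus7Printed.field x).2 1 ∧ (faultBus7Printed.field x).2 1 ≤ tubeHi9 1 := by
    rw [faultBus7Printed_field_snd, faultBus7_Pe_one]
    simp only [tubeLo9, tubeHi9, Pprinted, D_SP, M, Matrix.cons_val_one]
    push_cast
    constructor
    · rw [le_div_iff₀ (by norm_num)]; nlinarith
    · rw [div_le_iff₀ (by norm_num)]; nlinarith
  have hm2 : tubeLo9 2 ≤ (faultBus7Printed.field x).2 2 ∧ (faultBus7Printed.field x).2 2 ≤ tubeHi9 2 := by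
    rw [faultBus7Printed_field_snd, faultBus7_Pe_two]
    simp only [tubeLo9, tubeHi9, Pprinted, D_SP, M, Matrix.cons_val_two, Matrix.tail_cons,
      Matrix.head_cons]
    push_cast
    constructor
    · rw [le_div_iff₀ (by norm_num)]; nlinarith
    · rw [div_le_iff₀ (by norm_num)]; nlinarith
  intro i
  fin_cases i
  · exact hm0
  · exact hm1
  · exact hm2

/-- **THE FAULT-ON TUBE to `9/100 s` («bus 7 grounded», printed frame).**  For every `T ∈ [0, 9/100]`,
every solution `Y` of `faultBus7Printed` on `[0, T]` starting at synchronous speed (`ω(0) = 0`) from the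
printed pre-fault relative angles (`δ₂(0) − δ₁(0) ∈ a2Window`, `δ₃(0) − δ₁(0) ∈ a3Window`; the absolute
reference angle is free), and every `t ∈ [0, T]`: `tubeLo9_i·t ≤ ω_i(t) ≤ tubeHi9_i·t` and
`tubeLo9_i·t²/2 ≤ δ_i(t) − δ_i(0) ≤ tubeHi9_i·t²/2` (`i` = machine 1, 2, 3).  MODELLED: classical WSCC9 fault-on
model M′ (MV-2 + MV-P + MV-SPD + MV-h12).  [cite: Moore1979, §8.1 eqs. (8.5), (8.10); AndersonFouad1977,
Example 2.6] -/
theorem faultBus7_tube_9_100 {T : ℝ} (hT0 : 0 ≤ T) (hT : T ≤ 9 / 100) {Y : ℝ → ClassicalSwing.State 3}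
    (hY : faultBus7Printed.IsSolutionOn Y (Icc 0 T)) (hω0 : (Y 0).2 = 0)
    (ha2 : (Y 0).1 1 - (Y 0).1 0 ∈ a2Window) (ha3 : (Y 0).1 2 - (Y 0).1 0 ∈ a3Window) :
    ∀ t ∈ Icc 0 T, ∀ i : Fin 3,
      tubeLo9 i * t ≤ (Y t).2 i ∧ (Y t).2 i ≤ tubeHi9 i * t ∧
        tubeLo9 i * t ^ 2 / 2 ≤ (Y t).1 i - (Y 0).1 i ∧ (Y t).1 i - (Y 0).1 i ≤ tubeHi9 i * t ^ 2 / 2 := by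
  -- translate the reference angle to 0
  set r : ℝ := (Y 0).1 0 with hr
  set X : ℝ → ClassicalSwing.State 3 := fun t => (fun j => (Y t).1 j - r, (Y t).2) with hX
  have hfieldX : ∀ t, faultBus7Printed.field (X t) = faultBus7Printed.field (Y t) := by
    intro t
    have hPe : ∀ i, faultBus7Printed.Pe (fun j => (Y t).1 j - r) i = faultBus7Printed.Pe (Y t).1 i := by
      intro i
      have := Pe_add_const faultBus7Printed (Y t).1 (-r) i
      simpa [sub_eq_add_neg] using this
    ext i
    · rfl
    · simp only [ClassicalSwing.field, hX, hPe]
  have hXsol : ∀ t ∈ Icc 0 T, HasDerivWithinAt X (faultBus7Printed.field (X t)) (Icc 0 T) t := by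
    intro t ht
    rw [hfieldX]
    have h := hY t ht
    have hc : HasDerivWithinAt (fun _ : ℝ => ((fun _ : Fin 3 => r), (0 : Fin 3 → ℝ)))
        (0 : ClassicalSwing.State 3) (Icc 0 T) t := hasDerivWithinAt_const _ _ _
    have h2 := h.sub hc
    rw [sub_zero] at h2
    refine h2.congr (fun s _ => ?_) ?_ <;> (ext i <;> simp [hX])
  -- the tube theorem on X
  have hX0ω : (X 0).2 = 0 := by simp [hX, hω0]
  have hX01 : (X 0).1 0 = 0 := by simp [hX, hr]
  have hX02 : (X 0).1 1 = (Y 0).1 1 - (Y 0).1 0 := by simp [hX, hr]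
  have hX03 : (X 0).1 2 = (Y 0).1 2 - (Y 0).1 0 := by simp [hX, hr]
  obtain ⟨ha2l, ha2u⟩ := ha2
  obtain ⟨ha3l, ha3u⟩ := ha3
  have hT2 : T ^ 2 ≤ (9 / 100 : ℝ) ^ 2 := pow_le_pow_left₀ hT0 hT 2
  -- the four strict inclusions K(T) ⊂ int B
  have hlo0 : (0 : ℝ) < tubeLo9 0 ∧ (0 : ℝ) < tubeLo9 1 ∧ (0 : ℝ) < tubeLo9 2 := by
    simp only [tubeLo9, Matrix.cons_val_zero, Matrix.cons_val_one, Matrix.head_cons, Matrix.cons_val_two,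
      Matrix.tail_cons]; norm_num
  have hhi0 : (0 : ℝ) < tubeHi9 0 ∧ (0 : ℝ) < tubeHi9 1 ∧ (0 : ℝ) < tubeHi9 2 := by
    simp only [tubeHi9, Matrix.cons_val_zero, Matrix.cons_val_one, Matrix.head_cons, Matrix.cons_val_two,
      Matrix.tail_cons]; norm_num
  have hKa : ∀ i, boxA9 i < (X 0).1 i + min 0 ((X 0).2 i * T) + min (tubeLo9 i) 0 * T ^ 2 / 2 := by
    have e : ∀ i, (X 0).1 i + min 0 ((X 0).2 i * T) + min (tubeLo9 i) 0 * T ^ 2 / 2 = (X 0).1 i := by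
      intro i
      rw [hX0ω, Pi.zero_apply, zero_mul, min_self, add_zero]
      have : min (tubeLo9 i) 0 = 0 := by
        fin_cases i
        · exact min_eq_right hlo0.1.le
        · exact min_eq_right hlo0.2.1.le
        · exact min_eq_right hlo0.2.2.le
      rw [this]; ring
    intro i; rw [e]
    fin_cases i
    · show boxA9 0 < (X 0).1 0
      rw [hX01]; norm_num [boxA9]
    · show boxA9 1 < (X 0).1 1
      rw [hX02]; norm_num [boxA9] at ha2l ⊢; linarith
    · show boxA9 2 < (X 0).1 2
      rw [hX03]; norm_num [boxA9, Matrix.cons_val_two, Matrix.tail_cons, Matrix.head_cons] at ha3l ⊢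
      linarith
  have hKb : ∀ i, (X 0).1 i + max 0 ((X 0).2 i * T) + max (tubeHi9 i) 0 * T ^ 2 / 2 < boxB9 i := by
    have e : ∀ i, (X 0).1 i + max 0 ((X 0).2 i * T) + max (tubeHi9 i) 0 * T ^ 2 / 2 =
        (X 0).1 i + tubeHi9 i * T ^ 2 / 2 := by
      intro i
      rw [hX0ω, Pi.zero_apply, zero_mul, max_self, add_zero]
      have : max (tubeHi9 i) 0 = tubeHi9 i := by
        fin_cases i
        · exact max_eq_left hhi0.1.le
        · exact max_eq_left hhi0.2.1.le
        · exact max_eq_left hhi0.2.2.le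
      rw [this]
    intro i; rw [e]
    fin_cases i
    · show (X 0).1 0 + tubeHi9 0 * T ^ 2 / 2 < boxB9 0
      rw [hX01]; norm_num [boxB9, tubeHi9] at hT2 ⊢; nlinarith [hT2]
    · show (X 0).1 1 + tubeHi9 1 * T ^ 2 / 2 < boxB9 1
      rw [hX02]; norm_num [boxB9, tubeHi9] at ha2u hT2 ⊢; nlinarith [hT2]
    · show (X 0).1 2 + tubeHi9 2 * T ^ 2 / 2 < boxB9 2
      rw [hX03]
      norm_num [boxB9, tubeHi9, Matrix.cons_val_two, Matrix.tail_cons, Matrix.head_cons] at ha3u hT2 ⊢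
      nlinarith [hT2]
  have hKc : ∀ i, boxC9 i < (X 0).2 i + min (tubeLo9 i) 0 * T := by
    intro i
    rw [hX0ω, Pi.zero_apply]
    fin_cases i
    · show boxC9 0 < 0 + min (tubeLo9 0) 0 * T
      rw [min_eq_right hlo0.1.le]; norm_num [boxC9]
    · show boxC9 1 < 0 + min (tubeLo9 1) 0 * T
      rw [min_eq_right hlo0.2.1.le]; norm_num [boxC9]
    · show boxC9 2 < 0 + min (tubeLo9 2) 0 * T
      rw [min_eq_right hlo0.2.2.le]
      norm_num [boxC9, Matrix.cons_val_two, Matrix.tail_cons, Matrix.head_cons]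
  have hKd : ∀ i, (X 0).2 i + max (tubeHi9 i) 0 * T < boxD9 i := by
    intro i
    rw [hX0ω, Pi.zero_apply, zero_add]
    fin_cases i
    · show max (tubeHi9 0) 0 * T < boxD9 0
      rw [max_eq_left hhi0.1.le]; norm_num [boxD9, tubeHi9]; nlinarith [hT]
    · show max (tubeHi9 1) 0 * T < boxD9 1
      rw [max_eq_left hhi0.2.1.le]; norm_num [boxD9, tubeHi9]; nlinarith [hT]
    · show max (tubeHi9 2) 0 * T < boxD9 2
      rw [max_eq_left hhi0.2.2.le]
      norm_num [boxD9, tubeHi9, Matrix.cons_val_two, Matrix.tail_cons, Matrix.head_cons]; nlinarith [hT]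
  have key := Literature.Analysis.ODE.secondOrder_tube_of_solution (F := faultBus7Printed.field)
    (fun _ => rfl) hT0 hXsol (lo := tubeLo9) (hi := tubeHi9) (a := boxA9) (b := boxB9) (c := boxC9) (d := boxD9)
    (fun x hx => faultBus7Printed_fieldBounds9 x hx) hKa hKb hKc hKd
  intro t ht i
  obtain ⟨k1, k2, k3, k4⟩ := key t ht i
  have e1 : (X t).2 i = (Y t).2 i := rfl
  have e2 : (X 0).2 i = 0 := by rw [hX0ω]; rfl
  have e3 : (X t).1 i - (X 0).1 i = (Y t).1 i - (Y 0).1 i := by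
    show ((Y t).1 i - r) - ((Y 0).1 i - r) = _; ring
  rw [e1, e2, sub_zero] at k1 k2
  rw [e3, e2, zero_mul, sub_zero] at k3 k4
  exact ⟨k1, k2, k3, k4⟩

end WSCC9

end Summit.Ventures.GridStability.Models

end
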